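import Mathlib.Algebra.MvPolynomial.SchwartzZippel
import Literature.Algebra.Polynomial.IrreducibleCountFormula
import Literature.Computability.Complexity.PCPCoins
import Literature.Computability.Complexity.PromiseRPAmplification
import Literature.Computability.Complexity.LengthCompare
import Literature.Computability.MetaComplexity.GFDesignList
import HarnessLib

/-!
# The randomised zero test over a FIXED prime field: random monic modulus, random point in
# `𝔽_p[X]/(f)` ⇒ `coRP` (identity testing over `𝔽_p` as a POLYNOMIAL identity)

Class level plus counting (no machine is programmed here); the characteristic-`p` twin of
`RandomizedModularZeroTest.lean`. Over a fixed finite field `𝔽_p` a polynomial given by a succinct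
device (a circuit of size `s`) may have degree `2^s ≫ p`, so Schwartz–Zippel over `𝔽_p` itself is
useless and one evaluates in an EXTENSION field `𝔽_{p^k}` (Lidl–Niederreiter; the standard remark
behind "ACIT over finite fields is in coRP", e.g. Kabanets–Impagliazzo 2004, §2.3, Agrawal–Biswas
2003, §1). We avoid every irreducibility test (Rabin / Ben-Or) by the following one-sided test,
whose analysis is pure counting:

* draw a random MONIC `f = X^k + Σ_{j<k} c_j X^j ∈ 𝔽_p[X]` (coefficients from `k` blocks of `b`
  coins, `PCPCoins.dec`) and a random point `a ∈ (𝔽_p[X]/(f))^V` whose coordinates have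
  `{0,1}` coefficient vectors (`V` blocks of `k` coins), and accept iff `Q(a) = 0` in `𝔽_p[X]/(f)`;
* a zero polynomial is always accepted; for `Q ≠ 0` of total degree `≤ 2^d`: with probability
  `≥ I_p(k)/p^k - k p/2^b ≥ 1/(2k) - 1/(8k)` the coefficient blocks are good and `f` is irreducible
  (`two_mul_irrCount_ge`: `k · I_p(k) ≥ p^k / 2` from Gauss's count `Σ_{h ∣ k} h I_p(h) = p^k`,
  the tree's `NiederreiterQualityBound.sum_divisors_mul_irrCount` / `IrreducibleCountFormula.mul_irrCount_le_pow`;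
  `PCPCoins.uniformProb_bad_or_dec_le`),
  and GIVEN an irreducible `f` the ring `𝔽_p[X]/(f)` is the field `𝔽_{p^k}` in which the `2^k` points
  with `{0,1}` coordinates are distinct, so Schwartz–Zippel (Mathlib) bounds `Pr[Q(a) = 0]` by
  `2^d / 2^k ≤ 1/(8k)` for `k = 2d + 8`; the one-sided gap `1/(4k)` is then `coRP` by the tree's
  `mem_PromiseCoRP'_of_weak` (`PromiseRPAmplification.lean`).

Main results (everything proved; definitions are the coin layout only):

* `ExtFieldZeroTest.two_mul_irrCount_ge` — `p^k ≤ 2 · (k · I_p(k))` for `k ≥ 3` over any finite field;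
* `ExtFieldZeroTest.modRow`, `modPoly` (the modulus `f` read off the coins), `bitRow`, `ptOf`
  (the point), `kOf`, `bOf`, `coinPoly`, `gapPoly` (parameters);
* `ExtFieldZeroTest.uniformProb_aeval_ptOf_eq_zero_le` — Schwartz–Zippel on coin blocks in
  `𝔽_p[X]/(f)`, `f` irreducible of degree `k`; `uniformProb_not_irreducible_le` — the random monic is
  reducible with probability `≤ k p/2^b + (1 - 1/(2k))`; `uniformProb_prefix_le` — conditioning on a prefix;
* `ExtFieldZeroTest.uniformProb_accept_le` — the one-trial analysis;
* **`ExtFieldZeroTest.mem_coRP_of_extFieldZeroTest`** — given `sem : w ↦ Q_w ∈ 𝔽_p[x_0, …, x_{v(|w|)-1}]`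
  with `deg Q_w ≤ 2^{d(|w|)}` and an `FP` one-bit `E` with `E ⟨w, y⟩ = 1 ↔ Q_w(a_y) = 0` in
  `𝔽_p[X]/(f_y)`, the language `{w | Q_w = 0}` is in `coRP` (and in `BPP`, `mem_BPP_of_extFieldZeroTest`).

Consumer: `AlgebraicComplexity/CircuitCodeExtFieldEvaluator.lean` (the `FP` evaluator of integer
circuit codes in `𝔽_p[X]/(f)`) and `AlgebraicComplexity/PITLanguageModP.lean` (identity testing of
integer circuits MODULO `p` is in `coRP`: the characteristic-`p` half of the `∃BPP` verifier of
Bläser–Ikenmeyer–Jindal–Lysikov 2018, Thm. 4). HONEST FRAMING: textbook randomised identity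
testing; `VP ≠ VNP` is NOT proved and nothing here bears on it.

## References

* R. Lidl, H. Niederreiter, *Introduction to Finite Fields and Their Applications*, rev. ed., CUP 1994
  (held copy `book:lidlnd-introduction-finite-fields-their-applications`), Cor. 3.21 (Gauss's count
  `q^n = Σ_{d ∣ n} d N_q(d)`, PDF p. 91), Thm. 3.25 (the number `N_q(n)` of monic irreducible polynomials
  of degree `n`, PDF p. 92, with the crude estimate `N_q(n) ≥ (q^n - (q^n - q)/(q-1))/n > 0`),
  Exercise 3.27 (`N_q(n) ≥ q^n/n - q (q^{n/2} - 1)/(n(q-1))`, PDF p. 132) [LidlNiederreiter1994].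
* H. Niederreiter, *Random Number Generation and Quasi-Monte Carlo Methods*, SIAM 1992, Lemma 4.53
  (the tree's `NiederreiterQualityBound.lean`) [Niederreiter1992].
* J. T. Schwartz, J. ACM 27 (1980), Lemma 1 / Cor. 1 (Schwartz–Zippel over any field and any finite
  sample set) [Schwartz1980]; R. Zippel, EUROSAM 1979.
* M. Agrawal, S. Biswas, *Primality and identity testing via Chinese remaindering*, J. ACM 50 (2003)
  429–443, §1 (identity testing over finite fields by arithmetic modulo random low-degree polynomials
  instead of a constructed irreducible one; their test draws the modulus from a structured family to
  save random bits — here the plain uniform monic suffices) [AgrawalBiswas2003].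
* S. Arora, B. Barak, *Computational Complexity: A Modern Approach*, CUP 2009, Lemma 7.5 / A.36,
  §7.4.1 (error reduction), Lemma A.31 (coins to residues) [AroraBarakCC2009].
-/

noncomputable section

namespace Literature.Computability.Complexity

open _root_.Computability Polynomial Finset
open Literature.Analysis.Quadrature
open Literature.Algebra.Polynomial.IrreducibleCountFormula (mul_irrCount_le_pow)
open Literature.Computability.MetaComplexity

namespace ExtFieldZeroTest

/-! ### The number of monic irreducible polynomials of degree `k` over a finite field -/

section IrrCount

variable (F : Type*) [Field F] [Fintype F] [DecidableEq F]

/-- A geometric sum below a power: `Σ_{h ∈ [1, m]} q^h < q^{m+1}` for `q ≥ 2`. [folklore] -/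
private theorem sum_Icc_pow_lt {q : ℕ} (hq : 2 ≤ q) (m : ℕ) : ∑ h ∈ Finset.Icc 1 m, q ^ h < q ^ (m + 1) := by
  induction m with
  | zero => simp; omega
  | succ m ih =>
    rw [Finset.sum_Icc_succ_top (by omega)]
    calc ∑ k ∈ Finset.Icc 1 m, q ^ k + q ^ (m + 1) < q ^ (m + 1) + q ^ (m + 1) := by omega
      _ = 2 * q ^ (m + 1) := by ring
      _ ≤ q * q ^ (m + 1) := Nat.mul_le_mul_right _ hq
      _ = q ^ (m + 1 + 1) := by ring

/-- **`k · I_q(k) ≥ q^k / 2` for `k ≥ 3`**: from Gauss's count, `k I_q(k) = q^k - Σ_{h ∣ k, h < k} h I_q(h)`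
and the proper divisors of `k` are `≤ k/2`, so the subtracted sum is `≤ Σ_{h ≤ k/2} q^h < q^{⌊k/2⌋+1}`,
`2 q^{⌊k/2⌋+1} ≤ q^k` (a weak form of Lidl–Niederreiter, Exercise 3.27:
`N_q(k) ≥ q^k/k - q (q^{k/2} - 1)/(k (q-1))`).
[cite: LidlNiederreiter1994, Cor. 3.21 (PDF p. 91) and Exercise 3.27 (PDF p. 132)] -/
theorem two_mul_irrCount_ge {k : ℕ} (hk : 3 ≤ k) :
    Fintype.card F ^ k ≤ 2 * (k * irrCount F k) := by
  classical
  have hq2 : 2 ≤ Fintype.card F := Fintype.one_lt_card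
  have hk0 : k ≠ 0 := by omega
  have hgauss := sum_divisors_mul_irrCount (F := F) hk0
  -- split off the term `h = k`
  rw [← Nat.cons_self_properDivisors hk0, Finset.sum_cons] at hgauss
  -- the proper divisors are in `[1, k/2]`
  have hsub : k.properDivisors ⊆ Finset.Icc 1 (k / 2) := by
    intro h hh
    rw [Nat.mem_properDivisors] at hh
    rw [Finset.mem_Icc]
    refine ⟨Nat.pos_of_dvd_of_pos hh.1 (by omega), ?_⟩
    obtain ⟨c, hc⟩ := hh.1
    have hc2 : 2 ≤ c := by
      by_contra hlt
      interval_cases c <;> omega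
    calc h = h * 2 / 2 := by omega
      _ ≤ h * c / 2 := Nat.div_le_div_right (Nat.mul_le_mul_left h hc2)
      _ = k / 2 := by rw [hc]
  have hrest : ∑ h ∈ k.properDivisors, h * irrCount F h < Fintype.card F ^ (k / 2 + 1) :=
    calc ∑ h ∈ k.properDivisors, h * irrCount F h ≤ ∑ h ∈ k.properDivisors, Fintype.card F ^ h :=
          Finset.sum_le_sum fun h hh => mul_irrCount_le_pow (F := F) (Nat.pos_of_mem_properDivisors hh).ne'
      _ ≤ ∑ h ∈ Finset.Icc 1 (k / 2), Fintype.card F ^ h := Finset.sum_le_sum_of_subset hsub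
      _ < Fintype.card F ^ (k / 2 + 1) := sum_Icc_pow_lt hq2 _
  -- `2 q^{k/2+1} ≤ q^k`
  have hpow : 2 * Fintype.card F ^ (k / 2 + 1) ≤ Fintype.card F ^ k := by
    have hle : k / 2 + 2 ≤ k := by omega
    calc 2 * Fintype.card F ^ (k / 2 + 1) ≤ Fintype.card F * Fintype.card F ^ (k / 2 + 1) :=
          Nat.mul_le_mul_right _ hq2
      _ = Fintype.card F ^ (k / 2 + 2) := by ring
      _ ≤ Fintype.card F ^ k := Nat.pow_le_pow_right (by omega) hle
  omega

end IrrCount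

/-! ### Reading the modulus and the point off the coins -/

section Layout

variable (p : ℕ)

/-- **The coefficient row read off the coins**: entry `j < k` is the residue `mod p` of the value of
block `j` of length `b`, `y[jb, jb + b)` (`PCPCoins.dec`, written as a list, low coefficient first).
[cite: AroraBarakCC2009, Lemma A.31 (coins to residues)] -/
def modRow (b k : ℕ) (y : List Bool) : List (ZMod p) :=
  (List.range k).map fun j => ((bitsToNat ((y.drop (j * b)).take b) : ℕ) : ZMod p)

/-- **The random monic modulus** `f_y = X^k + Σ_{j<k} c_j X^j ∈ 𝔽_p[X]`.
[cite: AgrawalBiswas2003, §1 (arithmetic modulo random low-degree polynomials in place of an irreducible one)] -/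
def modPoly (b k : ℕ) (y : List Bool) : (ZMod p)[X] := X ^ k + GFDesign.ofList p (modRow p b k y)

/-- **A `{0,1}` coefficient row of length `k`** read off a bit block `u` (bit `j` of `u`, `false` past
its end). [cite: Schwartz1980, Lemma 1 (any finite sample set)] -/
def bitRow (k : ℕ) (u : List Bool) : List (ZMod p) :=
  (List.ofFn fun j : Fin k => u.getD j false).map fun c => if c then 1 else 0

/-- **The random point** of `(𝔽_p[X]/(f))^V` read off the point segment `z`: coordinate `i` is the
class of the `{0,1}`-polynomial of block `i` of length `k`, `z[ik, ik + k)`.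
[cite: Schwartz1980, Lemma 1] [cite: AroraBarakCC2009, Lemma 7.5] -/
def ptOf (k V : ℕ) (f : (ZMod p)[X]) (z : List Bool) : Fin V → AdjoinRoot f :=
  fun i => AdjoinRoot.mk f (GFDesign.ofList p (bitRow p k ((z.drop (i * k)).take k)))

variable {p}

/-- `|modRow| = k`. [cite: AroraBarakCC2009, Lemma A.31 (coins to residues)] -/
@[simp] theorem length_modRow (b k : ℕ) (y : List Bool) : (modRow p b k y).length = k := by
  simp [modRow]

/-- `modRow` is the list of `PCPCoins.dec`. [cite: AroraBarakCC2009, Lemma A.31 (coins to residues)] -/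
theorem modRow_eq_ofFn (b k : ℕ) (y : List Bool) : modRow p b k y = List.ofFn (PCPCoins.dec p b k y) := by
  refine List.ext_getElem (by simp [modRow]) fun j h₁ h₂ => ?_
  rw [List.getElem_ofFn, PCPCoins.dec_apply]
  simp [modRow]

/-- `|bitRow| = k`. [cite: Schwartz1980, Lemma 1 (finite sample set)] -/
@[simp] theorem length_bitRow (k : ℕ) (u : List Bool) : (bitRow p k u).length = k := by
  simp [bitRow]

/-- The modulus is monic. [cite: AgrawalBiswas2003, §1 (random monic modulus)] -/
theorem monic_modPoly [Fact p.Prime] (b k : ℕ) (y : List Bool) : (modPoly p b k y).Monic := by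
  rw [modPoly]
  refine (monic_X_pow k).add_of_left ?_
  rw [degree_X_pow]
  exact (GFDesign.degree_ofList_lt p _).trans_le (by simp)

/-- The modulus has degree `k`. [cite: AgrawalBiswas2003, §1 (random monic modulus of degree `k`)] -/
theorem natDegree_modPoly [Fact p.Prime] (b k : ℕ) (y : List Bool) : (modPoly p b k y).natDegree = k := by
  rw [modPoly, natDegree_add_eq_left_of_degree_lt, natDegree_X_pow]
  rw [degree_X_pow]
  exact (GFDesign.degree_ofList_lt p _).trans_le (by simp)

/-- Reading the modulus only looks at the first `k b` coins. [folklore] -/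
private theorem modRow_append {b k : ℕ} {u : List Bool} (hu : u.length = k * b) (z : List Bool) :
    modRow p b k (u ++ z) = modRow p b k u := by
  simp only [modRow]
  refine List.map_congr_left fun j hj => ?_
  rw [List.mem_range] at hj
  have hjb : j * b + b ≤ u.length := by rw [hu, ← Nat.succ_mul]; exact Nat.mul_le_mul_right b hj
  rw [List.drop_append_of_le_length (by omega), List.take_append_of_le_length (by simp; omega)]

/-- Hence so does the modulus. [folklore] -/
private theorem modPoly_append {b k : ℕ} {u : List Bool} (hu : u.length = k * b) (z : List Bool) :
    modPoly p b k (u ++ z) = modPoly p b k u := by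
  rw [modPoly, modPoly, modRow_append hu]

end Layout

/-! ### Schwartz–Zippel on coin blocks in `𝔽_p[X]/(f)`, `f` irreducible -/

section SZ

variable {p : ℕ} [hp : Fact p.Prime]

omit hp in
/-- Monotonicity of `uniformProb m` along inclusion on strings of length `m`. [folklore] -/
private theorem uniformProb_mono_len {m : ℕ} {E E' : Set (List Bool)}
    (h : ∀ y ∈ E, y.length = m → y ∈ E') : uniformProb m E ≤ uniformProb m E' := by
  rw [uniformProb_eq_cnt_div, uniformProb_eq_cnt_div]
  refine div_le_div_of_nonneg_right ?_ (by positivity)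
  exact_mod_cast PCPCoins.cnt_mono fun y hy hyE => h y hyE hy

/-- Base change does not increase the total degree (plumbing). [folklore] -/
private theorem totalDegree_map_le {R S σ : Type*} [CommSemiring R] [CommSemiring S]
    (f : R →+* S) (q : MvPolynomial σ R) : (MvPolynomial.map f q).totalDegree ≤ q.totalDegree :=
  Finset.sup_mono (MvPolynomial.support_map_subset f q)

/-- `bitRow` is injective on blocks of length `k` (`0 ≠ 1` in `𝔽_p`). [folklore] -/
private theorem bitRow_injOn {k : ℕ} {u v : List Bool} (hu : u.length = k) (hv : v.length = k)
    (h : bitRow p k u = bitRow p k v) : u = v := by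
  have h01 : Function.Injective (fun c : Bool => if c then (1 : ZMod p) else 0) := by
    intro c d hcd
    rcases c <;> rcases d <;> simp at hcd ⊢
  have h' := List.map_injective_iff.2 h01 h
  refine List.ext_getElem (hu.trans hv.symm) fun j h₁ h₂ => ?_
  have := congrArg (fun l => l.getD j false) h'
  rw [List.getD_eq_getElem _ _ (by simp; omega), List.getD_eq_getElem _ _ (by simp; omega),
    List.getElem_ofFn, List.getElem_ofFn, List.getD_eq_getElem _ _ h₁, List.getD_eq_getElem _ _ h₂] at this
  exact this

/-- **Classes of polynomials of degree `< deg f` are distinct** in `𝔽_p[X]/(f)`: `mk f` is injective on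
rows of length `k = deg f` ("each residue class `g + (f)` contains a unique representative `r` with
`deg r < deg f`"). [cite: LidlNiederreiter1994, §1.3 before Examples 1.62 (PDF p. 28)] -/
theorem ofList_injOn_mk {f : (ZMod p)[X]} {k : ℕ} (hf : f.natDegree = k) (hf0 : f ≠ 0)
    {l m : List (ZMod p)} (hl : l.length = k) (hm : m.length = k)
    (h : AdjoinRoot.mk f (GFDesign.ofList p l) = AdjoinRoot.mk f (GFDesign.ofList p m)) : l = m := by
  rw [AdjoinRoot.mk_eq_mk] at h
  have hdeg : (GFDesign.ofList p l - GFDesign.ofList p m).degree < f.degree := by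
    refine (degree_sub_le _ _).trans_lt (max_lt ?_ ?_)
    · rw [degree_eq_natDegree hf0, hf]; exact (GFDesign.degree_ofList_lt p l).trans_le (by rw [hl])
    · rw [degree_eq_natDegree hf0, hf]; exact (GFDesign.degree_ofList_lt p m).trans_le (by rw [hm])
  have h0 := eq_zero_of_dvd_of_degree_lt h hdeg
  exact GFDesign.ofList_injOn p (hl.trans hm.symm) (sub_eq_zero.1 h0)

/-- **A remainder row is zero iff its class vanishes**: for a row `l` of length `k = deg f`,
`[ofList l] = 0` in `𝔽_p[X]/(f)` iff `l` is the zero row (uniqueness of the representative of degree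
`< deg f`). [cite: LidlNiederreiter1994, §1.3 before Examples 1.62 (PDF p. 28)] -/
theorem mk_ofList_eq_zero_iff {f : (ZMod p)[X]} {k : ℕ} (hf : f.natDegree = k) (hf0 : f ≠ 0)
    {l : List (ZMod p)} (hl : l.length = k) :
    AdjoinRoot.mk f (GFDesign.ofList p l) = 0 ↔ l = List.replicate k 0 := by
  constructor
  · intro h
    refine ofList_injOn_mk hf hf0 hl (by simp) ?_
    rw [h, GFDesign.ofList_replicate_zero, map_zero]
  · rintro rfl
    rw [GFDesign.ofList_replicate_zero, map_zero]

/-- Block `i` of a string of `V` blocks of length `k` has length `k`. [folklore] -/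
private theorem length_block {k V i : ℕ} {z : List Bool} (hz : z.length = V * k) (hi : i < V) :
    ((z.drop (i * k)).take k).length = k := by
  simp only [List.length_take, List.length_drop, hz]
  have : (i + 1) * k ≤ V * k := Nat.mul_le_mul_right k hi
  rw [Nat.succ_mul] at this
  omega

/-- A string of `V` blocks of length `k` is determined by its blocks. [folklore] -/
private theorem eq_of_blocks_eq {k : ℕ} : ∀ {V : ℕ} {z z' : List Bool}, z.length = V * k → z'.length = V * k →
    (∀ i < V, (z.drop (i * k)).take k = (z'.drop (i * k)).take k) → z = z'
  | 0, z, z', hz, hz', _ => by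
    rw [Nat.zero_mul, List.length_eq_zero_iff] at hz hz'
    rw [hz, hz']
  | V + 1, z, z', hz, hz', h => by
    have h0 := h 0 (Nat.succ_pos V)
    simp only [Nat.zero_mul, List.drop_zero] at h0
    have hrest : z.drop k = z'.drop k :=
      eq_of_blocks_eq (k := k) (V := V) (by rw [List.length_drop, hz, Nat.succ_mul]; omega)
        (by rw [List.length_drop, hz', Nat.succ_mul]; omega)
        fun i hi => by
          have e1 : (z.drop k).drop (i * k) = z.drop ((i + 1) * k) := by rw [List.drop_drop]; congr 1; ring
          have e2 : (z'.drop k).drop (i * k) = z'.drop ((i + 1) * k) := by rw [List.drop_drop]; congr 1; ring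
          rw [e1, e2]
          exact h (i + 1) (by omega)
    rw [← List.take_append_drop k z, ← List.take_append_drop k z', h0, hrest]

/-- The sample set: the classes of the `2^k` polynomials with `{0,1}` coefficients and degree `< k`.
[cite: Schwartz1980, Lemma 1] -/
def sampleSet (p k : ℕ) (f : (ZMod p)[X]) : Finset (AdjoinRoot f) :=
  (Finset.univ : Finset (Fin k → Bool)).image fun u => AdjoinRoot.mk f (GFDesign.ofList p (bitRow p k (List.ofFn u)))

/-- `#sampleSet = 2^k` when `deg f = k`. [cite: Schwartz1980, Lemma 1] -/
theorem card_sampleSet {f : (ZMod p)[X]} {k : ℕ} (hf : f.natDegree = k) (hf0 : f ≠ 0) :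
    (sampleSet p k f).card = 2 ^ k := by
  classical
  rw [sampleSet, Finset.card_image_of_injective, Finset.card_univ, Fintype.card_fun, Fintype.card_bool,
    Fintype.card_fin]
  intro u v huv
  have h := ofList_injOn_mk hf hf0 (length_bitRow k _) (length_bitRow k _) huv
  have h' := bitRow_injOn (by simp) (by simp) h
  exact List.ofFn_injective h'

/-- **The strings with a given property of their point are at most as many as the sample points with
that property** (the blocks determine the string). [folklore] -/
private theorem cnt_ptOf_le {f : (ZMod p)[X]} {k : ℕ} (hf : f.natDegree = k) (hf0 : f ≠ 0) (V : ℕ)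
    (P : (Fin V → AdjoinRoot f) → Prop) [DecidablePred P] :
    cnt (V * k) {z | P (ptOf p k V f z)} ≤
      ((Fintype.piFinset fun _ : Fin V => sampleSet p k f).filter P).card := by
  classical
  unfold cnt
  refine card_le_card_of_injOn (fun r : List.Vector Bool (V * k) => ptOf p k V f r.toList)
    (fun r hr => ?_) (fun r hr r' hr' h => ?_)
  · simp only [coe_filter, mem_univ, true_and, Set.mem_setOf_eq] at hr
    simp only [coe_filter, Fintype.mem_piFinset, Set.mem_setOf_eq]
    refine ⟨fun i => ?_, hr⟩
    rw [sampleSet, mem_image]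
    refine ⟨fun j => ((r.toList.drop (i * k)).take k).getD j false, mem_univ _, ?_⟩
    simp only [ptOf]
    congr 2
    simp [bitRow]
  · apply List.Vector.toList_injective
    refine eq_of_blocks_eq (V := V) (k := k) (by simp) (by simp) fun i hi => ?_
    have hi' := congrFun h ⟨i, hi⟩
    simp only [ptOf] at hi'
    exact bitRow_injOn (length_block (by simp) hi) (length_block (by simp) hi)
      (ofList_injOn_mk hf hf0 (length_bitRow k _) (length_bitRow k _) hi')

/-- **Schwartz–Zippel on the coins in `𝔽_p[X]/(f)`**: for `f` irreducible of degree `k` and a nonzero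
`Q ∈ 𝔽_p[x_0, …, x_{V-1}]`, the point read off a uniform string of `V` blocks of `k` bits is a zero
of `Q` (in the field `𝔽_p[X]/(f) = 𝔽_{p^k}`) with probability `≤ deg Q / 2^k`.
[cite: Schwartz1980, Lemma 1 / Cor. 1] [cite: AroraBarakCC2009, Lemma 7.5] -/
theorem uniformProb_aeval_ptOf_eq_zero_le {f : (ZMod p)[X]} {k V : ℕ} (hirr : Irreducible f)
    (hf : f.natDegree = k) {Q : MvPolynomial (Fin V) (ZMod p)} (hQ : Q ≠ 0) :
    uniformProb (V * k) {z | MvPolynomial.aeval (ptOf p k V f z) Q = 0} ≤ (Q.totalDegree : ℝ) / 2 ^ k := by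
  classical
  haveI : Fact (Irreducible f) := ⟨hirr⟩
  have hf0 : f ≠ 0 := hirr.ne_zero
  set Q' := MvPolynomial.map (algebraMap (ZMod p) (AdjoinRoot f)) Q with hQ'
  have hQ'0 : Q' ≠ 0 := fun h => hQ (MvPolynomial.map_injective _ (algebraMap (ZMod p) (AdjoinRoot f)).injective
    (by rw [← hQ', h]; exact (map_zero _).symm))
  have hev : ∀ x : Fin V → AdjoinRoot f, MvPolynomial.aeval x Q = MvPolynomial.eval x Q' := fun x => by
    rw [hQ', MvPolynomial.eval_map, MvPolynomial.aeval_def]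
  have hdeg' : Q'.totalDegree ≤ Q.totalDegree := totalDegree_map_le _ _
  have hSZ := MvPolynomial.schwartz_zippel_totalDegree hQ'0 (sampleSet p k f)
  rw [card_sampleSet hf hf0] at hSZ
  have hS : (0 : ℚ≥0) < (2 ^ k : ℕ) := by exact_mod_cast Nat.two_pow_pos k
  have hSV : (0 : ℚ≥0) < ((2 ^ k : ℕ) : ℚ≥0) ^ V := pow_pos hS V
  rw [div_le_div_iff₀ hSV hS] at hSZ
  have hnat : ((Fintype.piFinset fun _ : Fin V => sampleSet p k f).filter
      fun x => MvPolynomial.eval x Q' = 0).card * 2 ^ k ≤ Q'.totalDegree * (2 ^ k) ^ V := by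
    exact_mod_cast hSZ
  have hcnt := cnt_ptOf_le hf hf0 V (fun x => MvPolynomial.eval x Q' = 0)
  have hset : {z | MvPolynomial.aeval (ptOf p k V f z) Q = 0} = {z | MvPolynomial.eval (ptOf p k V f z) Q' = 0} := by
    ext z; simp only [Set.mem_setOf_eq, hev]
  rw [hset, uniformProb_eq_cnt_div, div_le_div_iff₀ (by positivity) (by positivity)]
  have h1 : (cnt (V * k) {z | MvPolynomial.eval (ptOf p k V f z) Q' = 0} : ℝ) * 2 ^ k ≤
      (Q.totalDegree : ℝ) * (2 ^ k) ^ V := by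
    have h2 : cnt (V * k) {z | MvPolynomial.eval (ptOf p k V f z) Q' = 0} * 2 ^ k ≤ Q.totalDegree * (2 ^ k) ^ V :=
      ((Nat.mul_le_mul_right (2 ^ k) hcnt).trans hnat).trans (Nat.mul_le_mul_right _ hdeg')
    exact_mod_cast h2
  calc (cnt (V * k) {z | MvPolynomial.eval (ptOf p k V f z) Q' = 0} : ℝ) * 2 ^ k
      ≤ (Q.totalDegree : ℝ) * (2 ^ k) ^ V := h1
    _ = (Q.totalDegree : ℝ) * 2 ^ (V * k) := by rw [← pow_mul, mul_comm k V]

end SZ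

/-! ### The random modulus is irreducible with probability `≥ 1/(2k) - kp/2^b` -/

section Modulus

variable {p : ℕ} [hp : Fact p.Prime]

/-- The coefficient vectors `c` whose monic `X^k + Σ_j c_j X^j` is irreducible. [cite: LidlNiederreiter1994, Thm. 3.25 (PDF p. 92)] -/
def irrCoeffs (p : ℕ) [Fact p.Prime] (k : ℕ) : Finset (Fin k → ZMod p) := by
  classical exact Finset.univ.filter fun c => Irreducible (X ^ k + GFDesign.ofList p (List.ofFn c))

/-- The monic with a given coefficient vector is monic of degree `k`. [folklore] -/
private theorem monic_natDegree_ofFn (k : ℕ) (c : Fin k → ZMod p) :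
    (X ^ k + GFDesign.ofList p (List.ofFn c)).Monic ∧ (X ^ k + GFDesign.ofList p (List.ofFn c)).natDegree = k := by
  have hlt : (GFDesign.ofList p (List.ofFn c)).degree < (X ^ k : (ZMod p)[X]).degree := by
    rw [degree_X_pow]; exact (GFDesign.degree_ofList_lt p _).trans_le (by simp)
  exact ⟨(monic_X_pow k).add_of_left hlt, by rw [natDegree_add_eq_left_of_degree_lt hlt, natDegree_X_pow]⟩

/-- **`#irrCoeffs = I_p(k)`**: coefficient vectors ↔ monic polynomials of degree `k`.
[cite: LidlNiederreiter1994, Thm. 3.25 (PDF p. 92)] -/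
theorem card_irrCoeffs (k : ℕ) : (irrCoeffs p k).card = irrCount (ZMod p) k := by
  classical
  rw [irrCount]
  refine Finset.card_bij (fun c _ => X ^ k + GFDesign.ofList p (List.ofFn c)) (fun c hc => ?_)
    (fun c₁ hc₁ c₂ hc₂ h => ?_) (fun P hP => ?_)
  · rw [irrCoeffs, Finset.mem_filter] at hc
    rw [mem_monicIrreducibles]
    exact ⟨(monic_natDegree_ofFn k c).1, hc.2, (monic_natDegree_ofFn k c).2⟩
  · have h' := GFDesign.ofList_injOn p (by simp) (add_left_cancel h)
    exact List.ofFn_injective h'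
  · rw [mem_monicIrreducibles] at hP
    obtain ⟨hm, hi, hd⟩ := hP
    refine ⟨fun i => P.coeff i, ?_, ?_⟩
    · rw [irrCoeffs, Finset.mem_filter]
      refine ⟨Finset.mem_univ _, ?_⟩
      have : X ^ k + GFDesign.ofList p (List.ofFn fun i : Fin k => P.coeff i) = P := by
        rw [add_comm, ← hd]; exact GFDesign.ofList_lowCoeffs_add_X_pow p hm
      rw [this]; exact hi
    · rw [add_comm, ← hd]; exact GFDesign.ofList_lowCoeffs_add_X_pow p hm

omit hp in
/-- The modulus read off the coins is the monic of the decoded coefficient vector. [folklore] -/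
private theorem modPoly_eq_dec (b k : ℕ) (y : List Bool) :
    modPoly p b k y = X ^ k + GFDesign.ofList p (List.ofFn (PCPCoins.dec p b k y)) := by
  rw [modPoly, modRow_eq_ofFn]

/-- **A random monic of degree `k ≥ 3` over `𝔽_p`, read off `k` blocks of `b` coins, is reducible with
probability `≤ k p / 2^b + (1 - 1/(2k))`** (`PCPCoins.uniformProb_bad_or_dec_le` with the set of
reducible coefficient vectors, of size `p^k - I_p(k) ≤ p^k (1 - 1/(2k))` by `two_mul_irrCount_ge`).
[cite: LidlNiederreiter1994, Exercise 3.27 (PDF p. 132)] [cite: AroraBarakCC2009, Lemma A.31] -/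
theorem uniformProb_not_irreducible_le {k : ℕ} (hk : 3 ≤ k) (b : ℕ) :
    uniformProb (k * b) {u | ¬ Irreducible (modPoly p b k u)} ≤
      (k * p : ℝ) / 2 ^ b + (1 - 1 / (2 * k)) := by
  classical
  set A : Finset (Fin k → ZMod p) := Finset.univ \ irrCoeffs p k with hA
  have hsub : uniformProb (k * b) {u | ¬ Irreducible (modPoly p b k u)} ≤
      uniformProb (k * b) {ρ | ¬ PCPCoins.Good p b k ρ ∨ PCPCoins.dec p b k ρ ∈ A} := by
    refine uniformProb_mono_len fun u hu _ => Or.inr ?_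
    have hu' : ¬ Irreducible (X ^ k + GFDesign.ofList p (List.ofFn (PCPCoins.dec p b k u))) := by
      rw [← modPoly_eq_dec]; exact hu
    rw [hA, Finset.mem_sdiff, irrCoeffs, Finset.mem_filter]
    exact ⟨Finset.mem_univ _, fun h => hu' h.2⟩
  refine hsub.trans ((PCPCoins.uniformProb_bad_or_dec_le (p := p) (b := b) k A).trans ?_)
  refine add_le_add le_rfl ?_
  -- `#A / p^k ≤ 1 - 1/(2k)`
  have hcardA : A.card = p ^ k - irrCount (ZMod p) k := by
    rw [hA, Finset.card_univ_sdiff, card_irrCoeffs, Fintype.card_fun, Fintype.card_fin, ZMod.card]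
  have hI : p ^ k ≤ 2 * (k * irrCount (ZMod p) k) := by
    have h := two_mul_irrCount_ge (ZMod p) hk
    rwa [ZMod.card] at h
  have hIle : irrCount (ZMod p) k ≤ p ^ k := by
    have h := mul_irrCount_le_pow (F := ZMod p) (n := k) (by omega)
    rw [ZMod.card] at h
    exact le_trans (Nat.le_mul_of_pos_left _ (by omega)) h
  have hppos : (0 : ℝ) < (p : ℝ) ^ k := by
    have := hp.out.pos
    positivity
  have hkpos : (0 : ℝ) < k := by exact_mod_cast (show 0 < k by omega)
  rw [hcardA, Nat.cast_sub hIle, div_le_iff₀ hppos]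
  have hI' : ((p : ℝ) ^ k) ≤ 2 * (k * (irrCount (ZMod p) k : ℝ)) := by exact_mod_cast hI
  have h3 : (p : ℝ) ^ k / (2 * k) ≤ irrCount (ZMod p) k := by
    rw [div_le_iff₀ (by positivity)]; linarith
  have h4 : (1 - 1 / (2 * (k : ℝ))) * (p : ℝ) ^ k = (p : ℝ) ^ k - (p : ℝ) ^ k / (2 * k) := by
    field_simp
  push_cast
  rw [h4]
  linarith

end Modulus

/-! ### Conditioning on the modulus segment; the one-trial analysis -/

section Trial

variable {p : ℕ} [hp : Fact p.Prime]

omit hp in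
/-- **Conditioning on a prefix, in probabilities**: if on every prefix `u ∈ G` of length `m` the
conditional probability of `E` is `≤ δ`, then `Pr_{m+d}[E] ≤ δ + Pr_m[Gᶜ]`.
[cite: AroraBarakCC2009, §7.4.1] -/
theorem uniformProb_prefix_le (m d : ℕ) (E G : Set (List Bool)) {δ : ℝ} (hδ : 0 ≤ δ)
    (hG : ∀ u : List Bool, u.length = m → u ∈ G → uniformProb d {z | u ++ z ∈ E} ≤ δ) :
    uniformProb (m + d) E ≤ δ + uniformProb m Gᶜ := by
  classical
  rw [uniformProb_eq_cnt_div, uniformProb_eq_cnt_div m, PCPCoins.cnt_add_eq_sum_prefix, Nat.cast_sum]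
  have hterm : ∀ u : List.Vector Bool m, (cnt d {z | u.toList ++ z ∈ E} : ℝ) ≤
      δ * 2 ^ d + (if u.toList ∈ Gᶜ then (2 : ℝ) ^ d else 0) := by
    intro u
    by_cases hu : u.toList ∈ G
    · have h := hG u.toList (by simp) hu
      rw [uniformProb_eq_cnt_div, div_le_iff₀ (by positivity)] at h
      have : ¬ u.toList ∈ Gᶜ := fun h' => h' hu
      rw [if_neg this, add_zero]
      exact h
    · have : u.toList ∈ Gᶜ := hu
      rw [if_pos this]
      have h2 : (cnt d {z | u.toList ++ z ∈ E} : ℝ) ≤ 2 ^ d := by exact_mod_cast cnt_le d _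
      nlinarith [pow_pos (show (0 : ℝ) < 2 by norm_num) d]
  have hsum := Finset.sum_le_sum fun u (_ : u ∈ (Finset.univ : Finset (List.Vector Bool m))) => hterm u
  rw [Finset.sum_add_distrib, Finset.sum_const, Finset.card_univ, card_vector, Fintype.card_bool,
    Finset.sum_ite, Finset.sum_const_zero, add_zero, Finset.sum_const, nsmul_eq_mul, nsmul_eq_mul] at hsum
  have hcnt : ((Finset.univ.filter fun u : List.Vector Bool m => u.toList ∈ Gᶜ).card : ℝ) = cnt m Gᶜ := by
    unfold cnt; congr 2; ext u; simp only [Finset.mem_filter]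
  rw [hcnt] at hsum
  rw [div_le_iff₀ (by positivity), pow_add]
  push_cast at hsum ⊢
  have h2m : (0 : ℝ) < 2 ^ m := by positivity
  have h2d : (0 : ℝ) < 2 ^ d := by positivity
  calc (∑ u : List.Vector Bool m, (cnt d {z | u.toList ++ z ∈ E} : ℝ))
      ≤ 2 ^ m * (δ * 2 ^ d) + cnt m Gᶜ * 2 ^ d := hsum
    _ = (δ + cnt m Gᶜ / 2 ^ m) * (2 ^ m * 2 ^ d) := by field_simp

/-- **One trial**: for a nonzero `Q ∈ 𝔽_p[x_0, …, x_{V-1}]` and `k ≥ 3`, the test "`Q(a) = 0` in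
`𝔽_p[X]/(f)`" on a random monic `f` of degree `k` (from `k` blocks of `b` coins) and a random
`{0,1}`-coordinate point `a` (from `V` blocks of `k` coins) succeeds with probability at most
`deg Q / 2^k + k p / 2^b + (1 - 1/(2k))`. [cite: AgrawalBiswas2003, §1] [cite: Schwartz1980, Cor. 1] -/
theorem uniformProb_accept_le {b k V : ℕ} (hk : 3 ≤ k) {Q : MvPolynomial (Fin V) (ZMod p)} (hQ : Q ≠ 0) :
    uniformProb (k * b + V * k)
        {y | MvPolynomial.aeval (ptOf p k V (modPoly p b k y) (y.drop (k * b))) Q = 0} ≤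
      (Q.totalDegree : ℝ) / 2 ^ k + ((k * p : ℝ) / 2 ^ b + (1 - 1 / (2 * k))) := by
  have h := uniformProb_prefix_le (k * b) (V * k)
    {y | MvPolynomial.aeval (ptOf p k V (modPoly p b k y) (y.drop (k * b))) Q = 0}
    {u | Irreducible (modPoly p b k u)} (δ := (Q.totalDegree : ℝ) / 2 ^ k) (by positivity)
    (fun u hu hirr => by
      have hset : {z | u ++ z ∈ {y | MvPolynomial.aeval (ptOf p k V (modPoly p b k y) (y.drop (k * b))) Q = 0}} =
          {z | MvPolynomial.aeval (ptOf p k V (modPoly p b k u) z) Q = 0} := by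
        ext z
        simp only [Set.mem_setOf_eq]
        rw [modPoly_append hu, List.drop_left' hu]
      rw [hset]
      exact uniformProb_aeval_ptOf_eq_zero_le hirr (natDegree_modPoly b k u) hQ)
  refine h.trans (add_le_add le_rfl ?_)
  have hc : {u | Irreducible (modPoly p b k u)}ᶜ = {u | ¬ Irreducible (modPoly p b k u)} := rfl
  rw [hc]
  exact uniformProb_not_irreducible_le hk b

end Trial

/-! ### Parameters -/

section Params

variable (p : ℕ) (v d : Polynomial ℕ)

/-- Degree of the modulus (= block count = point block length): `k(n) = 2 d(n) + 8`, so that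
`2^{d(n)} / 2^{k(n)} ≤ 1/(8 k(n))`. [cite: AroraBarakCC2009, Lemma 7.5 (choice of the sample size)] -/
def kOf (n : ℕ) : ℕ := 2 * d.eval n + 8

/-- Coins per coefficient block: `b(n) = 2 k(n) + p + 3`, so that `k p / 2^b ≤ 1/(8k)`.
[cite: AroraBarakCC2009, Lemma A.31] -/
def bOf (n : ℕ) : ℕ := 2 * kOf d n + p + 3

/-- `k` as a polynomial. [folklore] -/
def kPoly : Polynomial ℕ := Polynomial.C 2 * d + Polynomial.C 8

/-- **Number of coins**: `k(n) b(n) + v(n) k(n)` (modulus blocks, then the point segment). [cite: AroraBarakCC2009, §7.1] -/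
def coinPoly : Polynomial ℕ :=
  kPoly d * (Polynomial.C 2 * kPoly d + Polynomial.C (p + 3)) + v * kPoly d

/-- The gap polynomial: one trial rejects a nonzero polynomial with probability `≥ 1/(gapPoly(n) + 1)`,
`gapPoly(n) + 1 = 4 k(n)`. [cite: AroraBarakCC2009, §7.4.1] -/
def gapPoly : Polynomial ℕ := Polynomial.C 8 * d + Polynomial.C 31

variable {p v d}

/-- Value of `kPoly`. [folklore] -/
@[simp] private theorem eval_kPoly (n : ℕ) : (kPoly d).eval n = kOf d n := by
  simp [kPoly, kOf]

/-- Value of `coinPoly`: `k b` modulus coins, then `V k` point coins. [cite: AroraBarakCC2009, §7.1 (coin strings of polynomial length)] -/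
theorem eval_coinPoly (n : ℕ) : (coinPoly p v d).eval n = kOf d n * bOf p d n + v.eval n * kOf d n := by
  simp only [coinPoly, bOf, eval_add, eval_mul, eval_kPoly, eval_C]
  ring

/-- Value of `gapPoly`: `gapPoly(n) + 1 = 4 k(n)`. [folklore] -/
private theorem eval_gapPoly_add_one (n : ℕ) : (gapPoly d).eval n + 1 = 4 * kOf d n := by
  simp [gapPoly, kOf]; ring

/-- `k ≥ 3` (indeed `≥ 8`; the modulus has positive degree). [cite: AroraBarakCC2009, Lemma 7.5 (choice of the sample size)] -/
theorem three_le_kOf (n : ℕ) : 3 ≤ kOf d n := by rw [kOf]; omega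

/-- **First numeric fact**: `8 k 2^d ≤ 2^k` (so `deg/2^k ≤ 1/(8k)`). [folklore] -/
private theorem eight_k_two_pow_d_le (n : ℕ) : 8 * kOf d n * 2 ^ d.eval n ≤ 2 ^ kOf d n := by
  rw [kOf]
  set e := d.eval n
  have h1 : e + 1 ≤ 2 ^ e := Nat.lt_two_pow_self
  have h2 : 8 * (2 * e + 8) ≤ 2 ^ (e + 8) := by
    rw [pow_add]
    have : (2 : ℕ) ^ 8 = 256 := by norm_num
    nlinarith
  calc 8 * (2 * e + 8) * 2 ^ e ≤ 2 ^ (e + 8) * 2 ^ e := Nat.mul_le_mul_right _ h2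
    _ = 2 ^ (2 * e + 8) := by rw [← pow_add]; ring_nf

/-- **Second numeric fact**: `8 k² p ≤ 2^b` (so `k p / 2^b ≤ 1/(8k)`). [folklore] -/
private theorem eight_k_sq_p_le (n : ℕ) : 8 * kOf d n ^ 2 * p ≤ 2 ^ bOf p d n := by
  rw [bOf]
  set k := kOf d n
  have hk : k ≤ 2 ^ k := Nat.lt_two_pow_self.le
  have hpp : p ≤ 2 ^ p := Nat.lt_two_pow_self.le
  have hk2 : k ^ 2 ≤ 2 ^ (2 * k) := by
    calc k ^ 2 ≤ (2 ^ k) ^ 2 := Nat.pow_le_pow_left hk 2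
      _ = 2 ^ (2 * k) := by rw [← pow_mul, mul_comm]
  calc 8 * k ^ 2 * p ≤ 8 * 2 ^ (2 * k) * 2 ^ p := Nat.mul_le_mul (Nat.mul_le_mul_left 8 hk2) hpp
    _ = 2 ^ (2 * k + p + 3) := by
        rw [show (8 : ℕ) = 2 ^ 3 by norm_num, ← pow_add, ← pow_add]; ring_nf

end Params

/-! ### The randomised extension-field zero test -/

section Main

variable {p : ℕ} [hp : Fact p.Prime] {v d : Polynomial ℕ}

/-- **The randomised extension-field zero test puts `{w | sem w = 0}` in `coRP`** (identity testing over
a fixed finite field `𝔽_p` as a POLYNOMIAL identity, by evaluation in `𝔽_p[X]/(f)` for a random monic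
`f`; Agrawal–Biswas 2003 §1, Schwartz 1980 Cor. 1, Lidl–Niederreiter Cor. 3.21 / Thm. 3.25). Data: a prime `p`;
to every string `w` (length `n`) a polynomial `sem w` over `𝔽_p` in `v(n)` variables of total degree
`≤ 2^{d(n)}`; a polynomial-time ONE-BIT function `E` which, on `⟨w, y⟩` with `y` of length
`k(n) b(n) + v(n) k(n)`, answers `1` iff `sem w` VANISHES at the point `ptOf` of the point segment
`y.drop (k b)` in the ring `𝔽_p[X]/(f_y)`, `f_y = modPoly p b k y` the monic read off the first `k`
blocks (this is what an evaluator working on remainder rows modulo `f_y` computes). Then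
`{w | sem w = 0} ∈ coRP`: a zero polynomial is accepted on every coin string; a nonzero one is
rejected by one trial with probability `≥ 1/(4 k(n))` (`uniformProb_accept_le` with the two numeric
facts), and `1/poly` one-sided gaps are `coRP` (`mem_PromiseCoRP'_of_weak`).
[cite: AgrawalBiswas2003, §1] [cite: Schwartz1980, Cor. 1] [cite: AroraBarakCC2009, Lemma 7.5 and §7.4.1] -/
theorem mem_coRP_of_extFieldZeroTest
    (sem : (w : List Bool) → MvPolynomial (Fin (v.eval w.length)) (ZMod p))
    (hdeg : ∀ w, (sem w).totalDegree ≤ 2 ^ d.eval w.length)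
    {E : List Bool → List Bool} (hE : E ∈ FP) (hbit : ∀ z, E z = [true] ∨ E z = [false])
    (hspec : ∀ w y, y.length = (coinPoly p v d).eval w.length →
      (E (boolPair w y) = [true] ↔
        MvPolynomial.aeval
          (ptOf p (kOf d w.length) (v.eval w.length) (modPoly p (bOf p d w.length) (kOf d w.length) y)
            (y.drop (kOf d w.length * bOf p d w.length))) (sem w) = 0)) :
    ({w | sem w = 0} : Language Bool) ∈ coRP := by
  classical
  set L'' : Language Bool := {z | E z = [true]} with hL''
  have hL''P : L'' ∈ Classes.P :=
    mem_P_of_mem_FP hE L'' fun z => ⟨fun hz => hz, fun hz => (hbit z).resolve_left hz⟩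
  have key : PromiseProblem.ofLanguage ({w | sem w = 0} : Language Bool) ∈ PromiseCoRP' := by
    refine mem_PromiseCoRP'_of_weak hL''P (coinPoly p v d) (gapPoly d) (fun w hw y hy => ?_) (fun w hw => ?_)
    · -- zero polynomials are always accepted
      have hw0 : sem w = 0 := hw
      change E (boolPair w y) = [true]
      rw [hspec w y hy, hw0, map_zero]
    · -- nonzero polynomials are rejected with probability `≥ 1/(4k)`
      have hw0 : sem w ≠ 0 := hw
      set n := w.length with hn
      set V := v.eval n
      set k := kOf d n with hk
      set b := bOf p d n with hb
      set Q := sem w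
      have hk3 : 3 ≤ k := three_le_kOf n
      have hkpos : (0 : ℝ) < k := by exact_mod_cast (show 0 < k by omega)
      have hacc := uniformProb_accept_le (p := p) (b := b) (V := V) hk3 hw0
      -- numerics
      have hN1 : (Q.totalDegree : ℝ) / 2 ^ k ≤ 1 / (8 * k) := by
        have h8 : ((8 * kOf d n * 2 ^ d.eval n : ℕ) : ℝ) ≤ ((2 ^ kOf d n : ℕ) : ℝ) := by
          exact_mod_cast eight_k_two_pow_d_le n
        have hdeg' : (Q.totalDegree : ℝ) ≤ ((2 ^ d.eval n : ℕ) : ℝ) := by exact_mod_cast hdeg w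
        push_cast at h8 hdeg'
        rw [div_le_div_iff₀ (by positivity) (by positivity)]
        rw [← hk] at h8
        nlinarith
      have hN2 : ((k : ℝ) * p) / 2 ^ b ≤ 1 / (8 * k) := by
        have h8 : ((8 * kOf d n ^ 2 * p : ℕ) : ℝ) ≤ ((2 ^ bOf p d n : ℕ) : ℝ) := by
          exact_mod_cast eight_k_sq_p_le (p := p) (d := d) n
        push_cast at h8
        rw [← hk, ← hb] at h8
        rw [div_le_div_iff₀ (by positivity) (by positivity)]
        nlinarith
      have hgap : (1 : ℝ) / (((gapPoly d).eval n : ℕ) + 1) = 1 / (4 * k) := by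
        have := eval_gapPoly_add_one (d := d) n
        have h' : (((gapPoly d).eval n : ℕ) : ℝ) + 1 = 4 * k := by rw [hk]; exact_mod_cast this
        rw [h']
      rw [hn] at hgap ⊢
      rw [hgap]
      -- the coin length is `k b + V k`
      have hlen : (coinPoly p v d).eval w.length = k * b + V * k := eval_coinPoly _
      rw [hlen]
      -- the rejected coin strings contain the non-accepting ones
      set A : Set (List Bool) :=
        {y | MvPolynomial.aeval (ptOf p k V (modPoly p b k y) (y.drop (k * b))) Q = 0} with hA
      have hmono : uniformProb (k * b + V * k) Aᶜ ≤ uniformProb (k * b + V * k) {y | boolPair w y ∉ L''} := by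
        refine uniformProb_mono_len fun y hy hylen => ?_
        change ¬ E (boolPair w y) = [true]
        rw [hspec w y (by rw [hlen]; exact hylen)]
        exact hy
      refine le_trans ?_ hmono
      rw [uniformProb_compl]
      have h4 : (1 : ℝ) / (4 * k) = 1 - (1 / (8 * k) + (1 / (8 * k) + (1 - 1 / (2 * k)))) := by
        field_simp; ring
      rw [h4]
      linarith [hacc, hN1, hN2]
  exact ofLanguage_mem_PromiseCoRP'_iff.1 key

/-- **… and hence in `BPP`** (`coRP ⊆ BPP`, through the promise classes). [cite: AroraBarakCC2009, §7.3] -/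
theorem mem_BPP_of_extFieldZeroTest
    (sem : (w : List Bool) → MvPolynomial (Fin (v.eval w.length)) (ZMod p))
    (hdeg : ∀ w, (sem w).totalDegree ≤ 2 ^ d.eval w.length)
    {E : List Bool → List Bool} (hE : E ∈ FP) (hbit : ∀ z, E z = [true] ∨ E z = [false])
    (hspec : ∀ w y, y.length = (coinPoly p v d).eval w.length →
      (E (boolPair w y) = [true] ↔
        MvPolynomial.aeval
          (ptOf p (kOf d w.length) (v.eval w.length) (modPoly p (bOf p d w.length) (kOf d w.length) y)
            (y.drop (kOf d w.length * bOf p d w.length))) (sem w) = 0)) :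
    ({w | sem w = 0} : Language Bool) ∈ BPP :=
  ofLanguage_mem_PromiseBPP'_iff.1 (PromiseCoRP'_subset_PromiseBPP'
    (ofLanguage_mem_PromiseCoRP'_iff.2 (mem_coRP_of_extFieldZeroTest sem hdeg hE hbit hspec)))

end Main




end ExtFieldZeroTest

end Literature.Computability.Complexity

end
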